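import Summits.CriticalPhenomena.PercolationContinuityZ3.Theorems.PercNearOneGluingNoHeavyPcintChainMemZ6C10Defs
import HarnessLib

/-!
# PCINT lane, kernel reduced-state B3c certificate `Z6C10` (bond, d = 6, memory τ = 10, kc = 4, 6192 state classes): row checks 2 (rows [600, 1200))

Cell `prim-pcint`, seat `prim-pcint-2` (gen 4); memo `run/shared/lean/prim/pcint/REDUCTIONS.md` §B3c and HANDOFF ("B3c on reduced states").
Does NOT build on p205010.  Data for `BondK.le_criticalProb_of_checkRowsC` (`…PcintChainMemKernelCert`): `p = 9305/100000`, chain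
parameter `kc = 4`, `s̄ = 99567/100000` (`s̄²+p² ≥ 1`), refund `r = 100435/100000` (`s̄·r ≥ 1`, `(1-p)·r² ≤ 1`), `κ̄ = (100000²+99567²)/(2·100000²)`,
`λ = 99999/100000`; Collatz–Wielandt weights (scale 10⁹) from a power iteration (ρ ≈ 0.9998183), exact off-line max row ratio
0.9998183042 < λ.  Generated by work/gen/gen_b3c_kernel.py (prim-pcint-2 gen 4 folder; copy in
run/shared/lean/prim/pcint/prim-pcint-2/kernel/); the kernel re-checks every row.
-/

namespace Summit.CriticalPhenomena.PercolationContinuityZ3.Theorems.Pcint.ChainMemZ6C10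

set_option maxHeartbeats 0 in
/-- Rows `[600, 700)` pass the check. [folklore] -/
theorem chk_600 : WinK.allRange (BondK.checkRowC 10 4 6 6192 9305 100435 99567 100000 99999 100000 ChainMemZ6C10.syms ChainMemZ6C10.tree) 600 700 = true :=
  WinK.allRange_of_allRangeB (fuel := 8) (lo := 600) (len := 100) (by decide +kernel)

set_option maxHeartbeats 0 in
/-- Rows `[700, 800)` pass the check. [folklore] -/
theorem chk_700 : WinK.allRange (BondK.checkRowC 10 4 6 6192 9305 100435 99567 100000 99999 100000 ChainMemZ6C10.syms ChainMemZ6C10.tree) 700 800 = true :=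
  WinK.allRange_of_allRangeB (fuel := 8) (lo := 700) (len := 100) (by decide +kernel)

set_option maxHeartbeats 0 in
/-- Rows `[800, 900)` pass the check. [folklore] -/
theorem chk_800 : WinK.allRange (BondK.checkRowC 10 4 6 6192 9305 100435 99567 100000 99999 100000 ChainMemZ6C10.syms ChainMemZ6C10.tree) 800 900 = true :=
  WinK.allRange_of_allRangeB (fuel := 8) (lo := 800) (len := 100) (by decide +kernel)

set_option maxHeartbeats 0 in
/-- Rows `[900, 1000)` pass the check. [folklore] -/
theorem chk_900 : WinK.allRange (BondK.checkRowC 10 4 6 6192 9305 100435 99567 100000 99999 100000 ChainMemZ6C10.syms ChainMemZ6C10.tree) 900 1000 = true :=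
  WinK.allRange_of_allRangeB (fuel := 8) (lo := 900) (len := 100) (by decide +kernel)

set_option maxHeartbeats 0 in
/-- Rows `[1000, 1100)` pass the check. [folklore] -/
theorem chk_1000 : WinK.allRange (BondK.checkRowC 10 4 6 6192 9305 100435 99567 100000 99999 100000 ChainMemZ6C10.syms ChainMemZ6C10.tree) 1000 1100 = true :=
  WinK.allRange_of_allRangeB (fuel := 8) (lo := 1000) (len := 100) (by decide +kernel)

set_option maxHeartbeats 0 in
/-- Rows `[1100, 1200)` pass the check. [folklore] -/
theorem chk_1100 : WinK.allRange (BondK.checkRowC 10 4 6 6192 9305 100435 99567 100000 99999 100000 ChainMemZ6C10.syms ChainMemZ6C10.tree) 1100 1200 = true :=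
  WinK.allRange_of_allRangeB (fuel := 8) (lo := 1100) (len := 100) (by decide +kernel)

/-- Rows `[600, 1200)` pass the check. [folklore] -/
theorem file_2 : WinK.allRange (BondK.checkRowC 10 4 6 6192 9305 100435 99567 100000 99999 100000 ChainMemZ6C10.syms ChainMemZ6C10.tree) 600 1200 = true := (WinK.allRange_split (WinK.allRange_split (WinK.allRange_split (WinK.allRange_split (WinK.allRange_split chk_600 chk_700) chk_800) chk_900) chk_1000) chk_1100)

end Summit.CriticalPhenomena.PercolationContinuityZ3.Theorems.Pcint.ChainMemZ6C10
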